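import Literature.Probability.FitznerVanDerHofstad2017.SrwIntegralLargeD
import Mathlib.MeasureTheory.Function.L2Space
import HarnessLib

/-!
# The SCALED large-`d` enclosure of the SRW inputs: Cauchy–Schwarz form of the Taylor remainder

CITATION HEADER. This module is part of a certified REPRODUCTION of:
  R. Fitzner, R. van der Hofstad, *Generalized approach to the non-backtracking lace expansion*,
  PTRF **169** (2017) 1041–1119 [NoBLE17], §5 ((5.1) p. 1090: the SRW inputs `I_{n,l}(x)`), as
  consumed by *Mean-field behavior for nearest-neighbor percolation in `d > 10`*, EJP **22** (2017)
  no. 43 [FvdH17], Thm 1.1, and of the "monotonicity in `d`" passage [NoBLE17] §2.5 p. 1062.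

`SrwIntegralLargeD.lean` proves the finite Taylor form (`srwI_taylor`) and the enclosure
`abs_srwI_sub_taylor_le`, whose remainder `Σ_t C(R+t,t) I^{(D₀)}_{n+1-t,M}(0)` (`M = l+R+1` even) is an
ABSOLUTE number certified once at the anchor dimension `D₀`. For a certificate that is UNIFORM in
`d → ∞` one needs a remainder that decays like `d^{-M/2}`; this file supplies the kernel half of it:

* **`srwI_zero_le_sqrt_mul_sqrt`** — Cauchy–Schwarz on the torus: for even `M` and `d ≥ 4j+1`,
  `I^{(d)}_{j,M}(0) ≤ √(p^{(d)}_{2M}(0)) · √(I^{(d)}_{2j,0}(0))`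
  (`I_{j,M}(0) = ∫ D̂^M Ĉ^j`, `p_{2M}(0) = ∫ (D̂^M)²`, `I_{2j,0}(0) = ∫ (Ĉ^j)²`, all `dk/(2π)^d`);
* **`abs_srwI_sub_taylor_le_sqrt`** — hence, for `4(n+1)+1 ≤ D₀ ≤ d` and `M = l+R+1` even,
  `|I^{(d)}_{n+1,l}(x) - Σ_{i ≤ R} C(i+n,n) p^{(d)}_{l+i}(x)| ≤
   Σ_{t ≤ n} C(R+t,t) √(p^{(d)}_{2M}(0)) √(I^{(D₀)}_{2(n+1-t),0}(0))`
  (monotonicity of `I_{2j,0}(0)` in `d`, `srwI_zero_dim_anti`). Combined with the Gaussian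
  domination bound `p_{2M}(0;d) ≤ (2M-1)‼/(2d)^M` (`SrwReturnMomentBound.lean`) the remainder is
  `≤ Σ_t C(R+t,t) √((2M-1)‼ · I^{(D₀)}_{2(n+1-t),0}(0)) · (2d)^{-M/2}` — explicit, and decaying in `d`.

No hypothesis of any theorem here is a programme-internal claim: all statements are kernel-proved
from the tree's definitions (`srwI`, `srwLaw`, `Dhat`, `Chat`, `P`).

## References
* [NoBLE17] R. Fitzner, R. van der Hofstad, PTRF 169 (2017) 1041–1119: (5.1) p. 1090; §2.5 p. 1062
  (bib key `FitznerVanDerHofstad2016NoBLE`).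
* [FvdH17] R. Fitzner, R. van der Hofstad, EJP 22 (2017) no. 43, Thm 1.1.
-/

noncomputable section

open MeasureTheory Real Finset Filter Topology
open scoped BigOperators Nat

namespace Literature.Probability.FitznerVanDerHofstad2017

open Literature.Barriers.CriticalPhenomena
open Literature.Barriers.CriticalPhenomena.Slade2006Prop53 (P μI)
open Literature.Barriers.CriticalPhenomena.LongRangePhi4 (srwLaw srwLaw_nonneg)
open DimMono

variable {d : ℕ}

/-- **Cauchy–Schwarz on the torus.** For even `M` and `d ≥ 4j+1`,
`I^{(d)}_{j,M}(0) ≤ √(p^{(d)}_{2M}(0)) · √(I^{(d)}_{2j,0}(0))`. [folklore] -/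
theorem srwI_zero_le_sqrt_mul_sqrt {j M : ℕ} (hM : Even M) (hd : 4 * j + 1 ≤ d) :
    srwI d j M 0 ≤ Real.sqrt (srwLaw d (2 * M) 0) * Real.sqrt (srwI d (2 * j) 0 0) := by
  have hπ : (0 : ℝ) < (2 * π) ^ d := by positivity
  have e1 : srwI d j M 0 = (∫ k, Dhat d k ^ M * Chat d 1 k ^ j ∂P d) / (2 * π) ^ d := by
    simp only [srwI, DhatSym_zero, mul_one]
  have e2 : srwLaw d (2 * M) 0 = (∫ k, Dhat d k ^ (2 * M) ∂P d) / (2 * π) ^ d := by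
    rw [← srwI_zero_eq_srwLaw]
    simp only [srwI, DhatSym_zero, mul_one, pow_zero]
  have e3 : srwI d (2 * j) 0 0 = (∫ k, Chat d 1 k ^ (2 * j) ∂P d) / (2 * π) ^ d := by
    simp only [srwI, DhatSym_zero, mul_one, pow_zero, one_mul]
  -- integrability / L² membership
  have hf_meas : AEStronglyMeasurable (fun k => Dhat d k ^ M) (P d) :=
    ((continuous_Dhat d).pow M).aestronglyMeasurable
  have hDint : Integrable (fun k => Dhat d k ^ (2 * M)) (P d) := by
    refine (integrable_const (1 : ℝ)).mono' ((continuous_Dhat d).pow (2 * M)).aestronglyMeasurable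
      (ae_of_all _ fun k => ?_)
    rw [Real.norm_eq_abs, abs_pow]
    exact abs_Dhat_pow_le_one (2 * M) k
  have hCint : Integrable (fun k => Chat d 1 k ^ (2 * j)) (P d) :=
    integrable_Chat_pow (2 * j) (by omega) zero_le_one le_rfl
  have hCjint : Integrable (fun k => Chat d 1 k ^ j) (P d) :=
    integrable_Chat_pow j (by omega) zero_le_one le_rfl
  have h2 : ENNReal.ofReal (2 : ℝ) = 2 := by simp
  have hf : MemLp (fun k => Dhat d k ^ M) (ENNReal.ofReal 2) (P d) := by
    rw [h2, memLp_two_iff_integrable_sq hf_meas]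
    have : (fun x => (Dhat d x ^ M) ^ 2) = fun x => Dhat d x ^ (2 * M) := by
      funext x; rw [← pow_mul, mul_comm]
    rw [this]
    exact hDint
  have hg : MemLp (fun k => Chat d 1 k ^ j) (ENNReal.ofReal 2) (P d) := by
    rw [h2, memLp_two_iff_integrable_sq hCjint.aestronglyMeasurable]
    have : (fun x => (Chat d 1 x ^ j) ^ 2) = fun x => Chat d 1 x ^ (2 * j) := by
      funext x; rw [← pow_mul, mul_comm]
    rw [this]
    exact hCint
  have hCS := integral_mul_le_Lp_mul_Lq_of_nonneg Real.HolderConjugate.two_two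
    (ae_of_all _ fun k => Even.pow_nonneg hM (Dhat d k))
    (ae_of_all _ fun k => pow_nonneg (Chat_one_nonneg k) j) hf hg
  have hA : (∫ k, (Dhat d k ^ M) ^ (2 : ℝ) ∂P d) = ∫ k, Dhat d k ^ (2 * M) ∂P d := by
    congr 1
    funext k
    rw [Real.rpow_two, ← pow_mul, mul_comm]
  have hB : (∫ k, (Chat d 1 k ^ j) ^ (2 : ℝ) ∂P d) = ∫ k, Chat d 1 k ^ (2 * j) ∂P d := by
    congr 1
    funext k
    rw [Real.rpow_two, ← pow_mul, mul_comm]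
  rw [hA, hB, ← Real.sqrt_eq_rpow, ← Real.sqrt_eq_rpow] at hCS
  rw [e1, e2, e3, Real.sqrt_div' _ hπ.le, Real.sqrt_div' _ hπ.le, div_mul_div_comm,
    Real.mul_self_sqrt hπ.le]
  exact div_le_div_of_nonneg_right hCS hπ.le

/-- **The scaled large-`d` enclosure (Cauchy–Schwarz form).** For `4(n+1)+1 ≤ D₀ ≤ d` and
`l+R+1 = M` even,
`|I^{(d)}_{n+1,l}(x) - Σ_{i ≤ R} C(i+n,n) p^{(d)}_{l+i}(x)| ≤
 Σ_{t ≤ n} C(R+t,t) √(p^{(d)}_{2M}(0)) √(I^{(D₀)}_{2(n+1-t),0}(0))`: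
Taylor form + `|I_{j,M}(x)| ≤ I_{j,M}(0)` + Cauchy–Schwarz + monotonicity of `I_{2j,0}(0)` in `d`.
The factor `√(p^{(d)}_{2M}(0)) ≤ √((2M-1)‼) (2d)^{-M/2}` (`SrwReturnMomentBound.lean`) carries the
decay in `d`; the anchors `I^{(D₀)}_{2j,0}(0)` are certified once, at `d = D₀`.
[cite: FitznerVanDerHofstad2016NoBLE, (5.1) p. 1090 and §2.5 p. 1062] -/
theorem abs_srwI_sub_taylor_le_sqrt {D₀ d n l R : ℕ} (hD : 4 * (n + 1) + 1 ≤ D₀) (hd : D₀ ≤ d)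
    (he : Even (l + R + 1)) (x : Fin d → ℤ) :
    |srwI d (n + 1) l x - ∑ i ∈ range (R + 1), (((i + n).choose n : ℕ) : ℝ) * srwLaw d (l + i) x|
      ≤ ∑ t ∈ range (n + 1), (((R + t).choose t : ℕ) : ℝ) *
          (Real.sqrt (srwLaw d (2 * (l + R + 1)) 0) *
            Real.sqrt (srwI D₀ (2 * (n + 1 - t)) 0 0)) := by
  refine (abs_srwI_sub_taylor_le (D₀ := d) (by omega) le_rfl he x).trans
    (sum_le_sum fun t ht => ?_)
  rw [mem_range] at ht
  refine mul_le_mul_of_nonneg_left ?_ (Nat.cast_nonneg _)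
  refine (srwI_zero_le_sqrt_mul_sqrt he (by omega)).trans ?_
  refine mul_le_mul_of_nonneg_left (Real.sqrt_le_sqrt ?_) (Real.sqrt_nonneg _)
  exact srwI_zero_dim_anti (j := 2 * (n + 1 - t)) (m := 0) ⟨0, rfl⟩ (by omega) hd

end Literature.Probability.FitznerVanDerHofstad2017

end
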